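import Summits.ResolutionOfSingularities.ResolutionOfSingularities.Theorems.MarkedTransferCampaignW46ThreefoldsGammaFreeGlobalCurveCentres
import Literature.AlgebraicGeometry.Resolution.QuasiExcellentCurveDelta
import Mathlib.RingTheory.DiscreteValuationRing.TFAE
import HarnessLib

/-!
# [OURS · L1 W4.6 rung (ii), dimension ladder] THE STRICT TRANSFORM OF ONE CURVE UNDER THE BLOWING UP OF A CLOSED POINT,
# WITH ITS `δ`-BOOKKEEPING (brick B8b of rung (ii-2) `GammaFreeGlobalOrderReductionDimLE p 2`; any ambient dimension)

Cell res-hironaka, LADDER-RESOLUTION rung L (D-0089), slot W4.6, rung (ii) (dimension ladder, res-L1-type-o1 p496755); seat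
res-D-pv-049 AS res-L1-s46-pv-11 (holder of rung (ii-2); architecture v2 on STATUS 2026-08-27T05:4xZ). Host route MarkedTransfer,
host item `HypersurfaceOrderReductionDimLeThree` (stmt-ResolutionOfSingularities-16156); proposed `--kind proof --supports` it
`--as helper`. Everything here is OURS scheme theory over the tree's blow-up library; nothing of H. Hironaka's manuscript
[Hironaka2017] is asserted. AI-written; AI review is weaker than expert review.

## What is proved

`CampaignW46.exists_strictTransform_pointBlowup` — for a locally Noetherian `X` (no regularity needed), a closed immersion `i : C ↪ X` of an
integral Noetherian quasi-excellent scheme `C` of dimension `≤ 1` (a component of the support of the ideal being reduced),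
a closed point `x` of `X` different from `i(η_C)`, and a blowing up `π : X′ → X` along `𝓘_{x}`: there are the STRICT TRANSFORM
`j : C₁ ↪ X′` (a closed immersion of an integral Noetherian quasi-excellent scheme of dimension `≤ 1`) and a proper birational
`ρ : C₁ → C` with `j ≫ π = ρ ≫ i`, the generic point of `C₁` lying over `i(η_C)`, such that the total `δ`-invariant does not go
up — `Σ_{y₁} δ(𝒪_{C₁,y₁}) ≤ Σ_y δ(𝒪_{C,y})` (both supports finite) — and DROPS STRICTLY when `x = i(c)` for a SINGULAR point `c` of
`C`. Construction: `C₁ := Bl_{i⁻¹𝓘_{x}𝒪_C}(C)`, `j` by the universal property of `π` (a closed immersion, GW 13.96 (2)); the three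
cases `x ∉ i(C)` (the centre on `C` is the unit ideal, `ρ` an isomorphism), `c` regular (`𝒪_{C,c}` a DVR, the centre `𝔪_c` is
Cartier, `ρ` an isomorphism: tree `IsBlowup.isIso`), `c` singular (Liu 9.2.32 / Kollár §1.4: `Σδ` drops, tree
`IsBlowup.finsum_pointDelta_strictTransform_lt`). This is the `Δ`-component bookkeeping of the d = 2 termination measure
`(Σδ, Σ(i−1), Σ(k−2)⁺)`: together with brick B8a (the prime divisors of the controlled transform are these strict transforms
plus the regular exceptional curve, whose `δ` vanishes) it gives `Δ(X′, J′) ≤ Δ(X, J)`, strictly if the blown-up point is a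
singular point of some component.

## Sources

* Q. Liu, *Algebraic Geometry and Arithmetic Curves* (2002), §9.2.4 Lemma 2.32, Thm. 8.1.19, §8.1 Prop. 1.26. [Liu2002]
* J. Kollár, *Lectures on Resolution of Singularities* (2007), §1.4. [Kollar2007]
* U. Görtz, T. Wedhorn, *Algebraic Geometry I*, 2nd ed. (2020), Prop. 13.96 (2), (13.19). [GortzWedhorn2020]
* H. Hironaka, ms. 2017-03-23, Def. 2.1 p.5 — scope only, under adjudication, not cited as fact. [Hironaka2017]
-/

noncomputable section

set_option linter.dupNamespace false -- mandated namespace of this single-conjunct summit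

open CategoryTheory AlgebraicGeometry TopologicalSpace IsLocalRing

namespace Summit.ResolutionOfSingularities.ResolutionOfSingularities.Theorems

namespace CampaignW46

open Literature.AlgebraicGeometry.Resolution
open Scheme.IdealSheafData
open Literature.AlgebraicGeometry.Hironaka2017

universe u

/-! ## Isomorphisms do not change `Σ δ` -/

/-- Along an isomorphism of integral schemes the total `δ`-invariant and the finiteness of its support are preserved.
[folklore] -/
theorem finsum_pointDelta_eq_of_isIso {C₁ C : Scheme.{u}} [IsIntegral C₁] [IsIntegral C] (e : C₁ ⟶ C) [IsIso e] :
    ∑ᶠ y, pointDelta C₁ y = ∑ᶠ y, pointDelta C y ∧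
      ((Function.support (pointDelta C)).Finite → (Function.support (pointDelta C₁)).Finite) := by
  have hst : ∀ y, pointDelta C₁ y = pointDelta C (e y) := fun y => by
    haveI : IsIso (e.stalkMap y) := (IsOpenImmersion.iff_isIso_stalkMap.mp inferInstance).2 y
    exact pointDelta_eq_of_isIso_stalkMap e y
  have hbij : Function.Bijective e := e.homeomorph.bijective
  refine ⟨finsum_eq_of_bijective e hbij hst, fun hfin => ?_⟩
  refine (hfin.preimage hbij.injective.injOn).subset fun y hy => ?_
  rw [Function.mem_support, hst] at hy
  exact hy

/-! ## A non-generic point of an integral scheme -/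

/-- The local ring at a point of an integral scheme other than the generic point is not a field (its dimension is the
codimension of the point, which is positive). [folklore] -/
theorem not_isField_stalk_of_ne_genericPoint {C : Scheme.{u}} [IsIntegral C] {c : C} (hc : c ≠ genericPoint C) :
    ¬ IsField (C.presheaf.stalk c) := by
  intro hF
  apply hc
  apply eq_genericPoint_of_coheight_eq_zero
  have h := ringKrullDim_stalk_eq_coheight c
  rw [ringKrullDim_eq_zero_of_isField hF] at h
  exact_mod_cast h.symm

/-- At a REGULAR non-generic point of an integral scheme of dimension `≤ 1` the local ring is a discrete valuation ring
(regular of dimension one: the maximal ideal is principal and non-zero). [folklore] -/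
theorem isDiscreteValuationRing_stalk_of_mem_regularLocus {C : Scheme.{u}} [IsIntegral C]
    (hdim : topologicalKrullDim C ≤ 1) {c : C} (hreg : c ∈ Scheme.regularLocus C) (hc : c ≠ genericPoint C) :
    IsDiscreteValuationRing (C.presheaf.stalk c) := by
  haveI : IsRegularLocalRing (C.presheaf.stalk c) := hreg
  have hnf := not_isField_stalk_of_ne_genericPoint hc
  have h1 : ringKrullDim (C.presheaf.stalk c) = 1 := (isField_or_ringKrullDim_eq_one hdim c).resolve_left hnf
  have hsp : (maximalIdeal (C.presheaf.stalk c)).spanFinrank = 1 := by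
    have h := IsRegularLocalRing.spanFinrank_maximalIdeal (R := C.presheaf.stalk c)
    rw [h1] at h
    exact_mod_cast h
  exact ((IsDiscreteValuationRing.TFAE (C.presheaf.stalk c) hnf).out 4 0).mp
    ((Submodule.spanFinrank_eq_one_iff _).mp hsp).1

/-! ## The strict transform of one curve under the blowing up of a closed point -/

/-- **[OURS · W4.6 rung (ii-2), brick B8b] The strict transform of an integral curve under the blowing up of a closed point,
with its `δ`-bookkeeping.** `X` locally Noetherian (regularity is not needed here); `i : C ↪ X` a closed immersion of an integral Noetherian
quasi-excellent scheme of dimension `≤ 1` whose generic point does not map to the closed point `x`; `π : X′ → X` a blowing up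
along `𝓘_{x}`. Then there are a closed immersion `j : C₁ ↪ X′` of an integral Noetherian quasi-excellent scheme of dimension
`≤ 1` and a proper birational `ρ : C₁ → C` with `j ≫ π = ρ ≫ i`, the generic point of `C₁` lying over `i(η_C)`, the `δ`-support
of `C₁` finite and `Σ δ(C₁) ≤ Σ δ(C)`; and if `x = i(c)` with `c` a SINGULAR point of `C` then `Σ δ(C₁) < Σ δ(C)`.
[cite: Liu2002, §9.2.4 Lemma 2.32] [cite: Kollar2007, §1.4] -/
theorem exists_strictTransform_pointBlowup {X X' C : Scheme.{u}} [IsLocallyNoetherian X]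
    (i : C ⟶ X) [IsClosedImmersion i] [IsIntegral C] [IsNoetherian C] (hC : Scheme.IsQuasiExcellent C)
    (hdim : topologicalKrullDim C ≤ 1) {x : X} (hx : IsClosed ({x} : Set X)) (hηx : i (genericPoint C) ≠ x)
    {π : X' ⟶ X} (hπ : IsBlowup π (vanishingIdeal ⟨{x}, hx⟩)) :
    ∃ (C₁ : Scheme.{u}) (j : C₁ ⟶ X') (ρ : C₁ ⟶ C), IsClosedImmersion j ∧ j ≫ π = ρ ≫ i ∧
      ∃ (_ : IsIntegral C₁) (_ : IsNoetherian C₁), Scheme.IsQuasiExcellent C₁ ∧ topologicalKrullDim C₁ ≤ 1 ∧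
      IsProper ρ ∧ IsBirational ρ ∧ π (j (genericPoint C₁)) = i (genericPoint C) ∧
      (Function.support (pointDelta C₁)).Finite ∧
      ∑ᶠ y, pointDelta C₁ y ≤ ∑ᶠ y, pointDelta C y ∧
      ((∃ c : C, i c = x ∧ c ∉ Scheme.regularLocus C) → ∑ᶠ y, pointDelta C₁ y < ∑ᶠ y, pointDelta C y) := by
  have hfinC : (Function.support (pointDelta C)).Finite := finite_support_pointDelta hC hdim
  -- the blowing up of `C` along the pulled-back centre, and its morphism to `X′`
  obtain ⟨C₁, ρ, hρ⟩ := exists_isBlowup C ((vanishingIdeal ⟨{x}, hx⟩).comap i)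
  let j : C₁ ⟶ X' := hπ.lift (ρ ≫ i) (by rw [Scheme.IdealSheafData.comap_comp]; exact hρ.isEffectiveCartier)
  have hj : j ≫ π = ρ ≫ i := hπ.lift_comp _ _
  haveI : IsClosedImmersion j := hπ.isClosedImmersion_of_comp_eq hρ hj
  by_cases hxC : x ∈ Set.range i
  · -- `x = i(c)`: the genuine strict transform
    obtain ⟨c, hcx⟩ := hxC
    have hcgen : c ≠ genericPoint C := fun h => hηx (h ▸ hcx)
    have hcf : ¬ IsField (C.presheaf.stalk c) := not_isField_stalk_of_ne_genericPoint hcgen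
    haveI : IsIntegral C₁ := hρ.isIntegral_strictTransform i hx hcx hcf
    obtain ⟨hN₁, hC₁⟩ := hρ.isLocallyNoetherian_and_isQuasiExcellent_strictTransform i hx hC
    haveI := hN₁
    haveI : IsProper ρ := hρ.isProper
    haveI : CompactSpace C₁ := QuasiCompact.compactSpace_of_compactSpace ρ
    haveI : IsNoetherian C₁ := {}
    have hdim₁ : topologicalKrullDim C₁ ≤ 1 := hρ.topologicalKrullDim_le hdim
    have hbir : IsBirational ρ := hρ.isBirational' (comap_vanishingIdeal_singleton_ne_bot i hx hcx hcf)
    have hgen : π (j (genericPoint C₁)) = i (genericPoint C) := by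
      rw [← Scheme.Hom.comp_apply, hj, Scheme.Hom.comp_apply, apply_genericPoint_of_isBirational hbir]
    by_cases hsing : c ∈ Scheme.regularLocus C
    · -- regular point: the centre `𝔪_c` is Cartier on `C`, `ρ` is an isomorphism
      haveI hDVR : IsDiscreteValuationRing (C.presheaf.stalk c) :=
        isDiscreteValuationRing_stalk_of_mem_regularLocus hdim hsing hcgen
      have hcart : IsEffectiveCartier ((vanishingIdeal ⟨{x}, hx⟩).comap i) := by
        refine isEffectiveCartier_of_stalkIdeal_eq_span_singleton fun y hy => ?_
        have hy' : y ∈ ((((vanishingIdeal ⟨{x}, hx⟩).comap i).support : Set C)) := hy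
        rw [support_comap_vanishingIdeal_singleton i hx hcx] at hy'
        obtain rfl : y = c := hy'
        obtain ⟨ϖ, hϖ⟩ := IsDiscreteValuationRing.exists_irreducible (C.presheaf.stalk y)
        refine ⟨ϖ, hϖ.ne_zero, ?_⟩
        rw [stalkIdeal_comap_vanishingIdeal_singleton i hx hcx]
        exact (IsDiscreteValuationRing.irreducible_iff_uniformizer ϖ).mp hϖ
      haveI : IsIso ρ := hρ.isIso hcart
      obtain ⟨heq, hfin⟩ := finsum_pointDelta_eq_of_isIso ρ
      refine ⟨C₁, j, ρ, inferInstance, hj, inferInstance, inferInstance, hC₁, hdim₁, inferInstance, hbir, hgen,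
        hfin hfinC, heq.le, ?_⟩
      rintro ⟨c', hc'x, hc'⟩
      exact absurd (i.isClosedEmbedding.injective (hc'x.trans hcx.symm) ▸ hsing) hc'
    · -- singular point: `Σδ` drops (Liu 9.2.32 / Kollár §1.4)
      obtain ⟨h1, hnd⟩ := ringKrullDim_eq_one_and_not_isDiscreteValuationRing_of_not_mem_regularLocus hdim hsing
      obtain ⟨hfin₁, hlt⟩ := hρ.finsum_pointDelta_strictTransform_lt i hx hcx hC hdim h1 hnd
      exact ⟨C₁, j, ρ, inferInstance, hj, inferInstance, inferInstance, hC₁, hdim₁, inferInstance, hbir, hgen, hfin₁,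
        hlt.le, fun _ => hlt⟩
  · -- `x ∉ i(C)`: the centre on `C` is the unit ideal, `ρ` is an isomorphism
    have htop : (vanishingIdeal ⟨{x}, hx⟩).comap i = ⊤ := by
      rw [← support_eq_bot_iff]
      ext y
      simp only [Scheme.IdealSheafData.support_comap, Closeds.coe_preimage, coe_support_vanishingIdeal, Closeds.coe_bot,
        Set.mem_preimage, Set.mem_empty_iff_false, iff_false]
      exact fun h => hxC ⟨y, h⟩
    haveI : IsIso ρ := hρ.isIso (by rw [htop]; exact isEffectiveCartier_top)
    haveI : Nonempty C₁ := ⟨(inv ρ) (genericPoint C)⟩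
    haveI : IsIntegral C₁ := isIntegral_of_isOpenImmersion ρ
    haveI : IsProper ρ := inferInstance
    haveI : IsLocallyNoetherian C₁ := LocallyOfFiniteType.isLocallyNoetherian ρ
    haveI : CompactSpace C₁ := QuasiCompact.compactSpace_of_compactSpace ρ
    haveI : IsNoetherian C₁ := {}
    have hC₁ : Scheme.IsQuasiExcellent C₁ := hρ.isQuasiExcellent hC
    have hdim₁ : topologicalKrullDim C₁ ≤ 1 := hρ.topologicalKrullDim_le hdim
    have hbir : IsBirational ρ := by
      refine ⟨⊤, by simp [dense_univ], by simp [dense_univ], ?_⟩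
      infer_instance
    have hgen : π (j (genericPoint C₁)) = i (genericPoint C) := by
      rw [← Scheme.Hom.comp_apply, hj, Scheme.Hom.comp_apply, apply_genericPoint_of_isBirational hbir]
    obtain ⟨heq, hfin⟩ := finsum_pointDelta_eq_of_isIso ρ
    refine ⟨C₁, j, ρ, inferInstance, hj, inferInstance, inferInstance, hC₁, hdim₁, inferInstance, hbir, hgen, hfin hfinC,
      heq.le, ?_⟩
    rintro ⟨c, hcx, -⟩
    exact absurd ⟨c, hcx⟩ hxC

end CampaignW46

end Summit.ResolutionOfSingularities.ResolutionOfSingularities.Theorems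

end
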